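import Mathlib
import Summits.Ventures.PercRepro2.HCov
import Summits.Ventures.PercRepro2.RootLeafUHalf
import Summits.Ventures.PercRepro2.RootLeafUMixK
import Summits.Ventures.PercRepro2.RootLeafUMixL
import Summits.Ventures.PercRepro2.RootLeafUOu
import Summits.Ventures.PercRepro2.RootLeafUTheorem
import Summits.Ventures.PercRepro2.RootLeafUStarMerge
import Summits.Ventures.PercRepro2.RootLeafUCoin3Pin
import Summits.Ventures.PercRepro2.RootLeafUCoin3TableA
import Summits.Ventures.PercRepro2.RootLeafUCoin3TableB
import Summits.Ventures.PercRepro2.RootLeafUCoin3TableC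
import Summits.Ventures.PercRepro2.RootLeafUCoin3TableD
import Summits.Ventures.PercRepro2.RootLeafUCoin3AlgK
import Summits.Ventures.PercRepro2.RootLeafUCoin3AlgL
import Summits.Ventures.PercRepro2.RootLeafUCoin3AlgL2
import Summits.Ventures.PercRepro2.RootLeafUCoin3Outside

/-!
# (G4-u) on the 3-coin class `N(b) = {a₂, u, c}`: `0 ≤ T2` and the (HCOV) corollary
(blind cell PercRepro2, p4 g17; S3 (G4-u) item (ad), proofs/P4-G17-COIN3.md)

`b` is adjacent exactly to the root `a₂` (edge `f₁`), the root `u` (edge `f₂`) and the mark `c`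
(edge `f₃`), with any weights.  THEOREM: `0 ≤ T2 p ends o a₂ c b u` (W1 of (G4-u)), hence (HCOV) at
`(o, a₁, a₂, c, b)` for a root `a₁` pendant at `u` follows from (HCOV) at `(o, u, a₂, c, b)`.

Proof: the mass table of RootLeafUCoin3TableA–D expresses every mass of the instance through the
pinned measure `p⁰ = p[f₃, f₂, f₁ ↦ 0]` (the outside instance `G − b`) and the three coins; the
outside identities of RootLeafUCoin3Outside (Qsplit on `G − b`, complements, one Harris inequality, the two BHK06 1.4
slacks `ℋ′₀ ≥ 0`, `δ_o₀ ≥ 0`) feed the algebraic theorems `mixK_of_table` / `mixL_of_table`, whose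
conclusions are the hypotheses of `MixK.T2oK_nonneg_of_mixK` and `MixL.T2oL_nonneg_of_mixL`.
-/

namespace Summit.Ventures.PercRepro2

open UnionCluster CovForm

namespace RootLeafU

namespace Coin3

variable {V : Type*} {E : Type*} [Fintype E] [DecidableEq E] [Fintype V] [DecidableEq V]
  {R : Type*} [Field R] [LinearOrder R] [IsStrictOrderedRing R]

section Main

variable (p : E → R) (ends : E → Sym2 V) (o u a₂ c b : V) (f₁ f₂ f₃ : E)

set_option maxHeartbeats 4000000 in
/-- **The `o ∈ K` half on the 3-coin class**: `0 ≤ T2oK`. -/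
theorem T2oK_nonneg_coin3 (hp : IsProbVec p)
    (hf₁ : ends f₁ = s(b, a₂)) (hf₂ : ends f₂ = s(b, u)) (hf₃ : ends f₃ = s(b, c))
    (hstar : ∀ e, (∃ y, ends e = s(b, y)) → e = f₁ ∨ e = f₂ ∨ e = f₃)
    (hua : u ≠ a₂) (hcu : c ≠ u) (hca : c ≠ a₂) (hub : u ≠ b) (ha2b : a₂ ≠ b) (hcb : c ≠ b)
    (hob : o ≠ b) :
    0 ≤ T2oK p ends o a₂ c b u := by
  refine MixK.T2oK_nonneg_of_mixK p ends o a₂ c b u hp ?_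
  unfold EQb3 PDb EQ3
  simp only [prob_univ]
  -- the coins are distinct edges
  have h12 : f₁ ≠ f₂ := by
    intro h
    rw [h, hf₂] at hf₁
    rcases Sym2.eq_iff.1 hf₁ with ⟨_, h2⟩ | ⟨h1, _⟩
    · exact hua h2
    · exact ha2b h1.symm
  have h13 : f₁ ≠ f₃ := by
    intro h
    rw [h, hf₃] at hf₁
    rcases Sym2.eq_iff.1 hf₁ with ⟨_, h2⟩ | ⟨h1, _⟩
    · exact hca h2
    · exact ha2b h1.symm
  have h23 : f₂ ≠ f₃ := by
    intro h
    rw [h, hf₃] at hf₂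
    rcases Sym2.eq_iff.1 hf₂ with ⟨_, h2⟩ | ⟨h1, _⟩
    · exact hcu h2
    · exact hub h1.symm
  -- the pinned (outside) measure and the outside facts
  have hp0 : IsProbVec (Function.update (Function.update (Function.update p f₃ 0) f₂ 0) f₁ 0) :=
    ((hp.update f₃ le_rfl zero_le_one).update f₂ le_rfl zero_le_one).update f₁ le_rfl zero_le_one
  have hsig := fact_sig (Function.update (Function.update (Function.update p f₃ 0) f₂ 0) f₁ 0) ends u a₂ c hp0
  have hmu := fact_mu (Function.update (Function.update (Function.update p f₃ 0) f₂ 0) f₁ 0) ends u a₂ c hp0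
  have hHs := fact_Hs (Function.update (Function.update (Function.update p f₃ 0) f₂ 0) f₁ 0) ends u a₂ c hp0
  have hh := prob_le_one hp0 (avoidAll ends a₂ {u})
  have hdcu := out_dcu (Function.update (Function.update (Function.update p f₃ 0) f₂ 0) f₁ 0) ends u a₂ c
  have hgap := gap_eq_Q p ends u a₂ b
  rw [Qsplit p ends u a₂ c, Qsplit p ends u a₂ c] at hgap
  rw [Qsplit_univ (Function.update (Function.update (Function.update p f₃ 0) f₂ 0) f₁ 0) ends u a₂ c] at hHs hh
  have hH0 := MixK.HoK_nonneg (Function.update (Function.update (Function.update p f₃ 0) f₂ 0) f₁ 0)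
    ends o a₂ c u hp0
  have hZ_tab := table_Z p ends u a₂ c b f₁ f₂ f₃ hf₁ hf₂ hf₃ hstar h12 h13 h23 hub ha2b
  have hD_tab := table_D p ends u a₂ c b f₁ f₂ f₃ hf₁ hf₂ hf₃ hstar h12 h13 h23 hub ha2b hcb
  have ht_tab := table_t p ends u a₂ c b f₁ f₂ f₃ hf₁ hf₂ hf₃ hstar h12 h13 h23 hub ha2b hcb
  have htp_tab := table_tp p ends u a₂ c b f₁ f₂ f₃ hf₁ hf₂ hf₃ hstar h12 h13 h23 hub ha2b hcb
  have hhb_tab := table_hb p ends u a₂ c b f₁ f₂ f₃ hf₁ hf₂ hf₃ hstar h12 h13 h23 ha2b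
  have hd0_tab := table_d0 p ends u a₂ c b f₁ f₂ f₃ hf₁ hf₂ hf₃ hstar h12 h13 h23 ha2b hcb
  have hTpbL_tab := table_TpbL p ends u a₂ c b f₁ f₂ f₃ hf₁ hf₂ hf₃ hstar h12 h13 h23 hub ha2b hcb
  have hTbK_tab := table_TbK p ends u a₂ c b f₁ f₂ f₃ hf₁ hf₂ hf₃ hstar h12 h13 h23 hub ha2b hcb
  have hTbL_tab := table_TbL p ends u a₂ c b f₁ f₂ f₃ hf₁ hf₂ hf₃ hstar h12 h13 h23 hub ha2b hcb
  have hTpbK_tab := table_TpbK p ends u a₂ c b f₁ f₂ f₃ hf₁ hf₂ hf₃ hstar h12 h13 h23 hub ha2b hcb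
  have hPDbL_tab := table_PDbL p ends u a₂ c b f₁ f₂ f₃ hf₁ hf₂ hf₃ hstar h12 h13 h23 hub ha2b hcb
  have hPDbK_tab := table_PDbK p ends u a₂ c b f₁ f₂ f₃ hf₁ hf₂ hf₃ hstar h12 h13 h23 hub ha2b hcb
  have hPDoK_tab := table_PDoK p ends o u a₂ c b f₁ f₂ f₃ hf₁ hf₂ hf₃ hstar h12 h13 h23 hub ha2b hcb hob
  have hTpoK_tab := table_TpoK p ends o u a₂ c b f₁ f₂ f₃ hf₁ hf₂ hf₃ hstar h12 h13 h23 hub ha2b hcb hob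
  have hTpoKbK_tab := table_TpoKbK p ends o u a₂ c b f₁ f₂ f₃ hf₁ hf₂ hf₃ hstar h12 h13 h23 hub ha2b hcb hob
  have hPDoKbL_tab := table_PDoKbL p ends o u a₂ c b f₁ f₂ f₃ hf₁ hf₂ hf₃ hstar h12 h13 h23 hub ha2b hcb hob
  have hTpoKbL_tab := table_TpoKbL p ends o u a₂ c b f₁ f₂ f₃ hf₁ hf₂ hf₃ hstar h12 h13 h23 hub ha2b hcb hob
  simp only [out_W0 (Function.update (Function.update (Function.update p f₃ 0) f₂ 0) f₁ 0) ends u a₂ c, out_P00 (Function.update (Function.update (Function.update p f₃ 0) f₂ 0) f₁ 0) ends u a₂ c, out_hua (Function.update (Function.update (Function.update p f₃ 0) f₂ 0) f₁ 0) ends u a₂, out_hca (Function.update (Function.update (Function.update p f₃ 0) f₂ 0) f₁ 0) ends a₂ c, out_hor (Function.update (Function.update (Function.update p f₃ 0) f₂ 0) f₁ 0) ends u a₂ c, out_P00oK (Function.update (Function.update (Function.update p f₃ 0) f₂ 0) f₁ 0) ends o u a₂ c, Qsplit_univ (Function.update (Function.update (Function.update p f₃ 0) f₂ 0) f₁ 0)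 ends u a₂ c, prob_univ] at *
  set a := p f₁ with hadef
  set s := p f₂ with hsdef
  set k := p f₃ with hkdef
  set D0 := prob (Function.update (Function.update (Function.update p f₃ 0) f₂ 0) f₁ 0) (PDEvent ends u a₂ c) with hD0def
  set t0 := prob (Function.update (Function.update (Function.update p f₃ 0) f₂ 0) f₁ 0) (TEvent ends u a₂ c) with ht0def
  set tp0 := prob (Function.update (Function.update (Function.update p f₃ 0) f₂ 0) f₁ 0) (TEvent ends a₂ u c) with htp0def
  set d00 := prob (Function.update (Function.update (Function.update p f₃ 0) f₂ 0) f₁ 0) (avoidAll ends a₂ {c}) with hd00def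
  set dcu := prob (Function.update (Function.update (Function.update p f₃ 0) f₂ 0) f₁ 0) (avoidAll ends a₂ {c} ∩ (connEvent ends u c)ᶜ) with hdcudef
  set PD0oK := prob (Function.update (Function.update (Function.update p f₃ 0) f₂ 0) f₁ 0) (PDEvent ends u a₂ c ∩ connEvent ends a₂ o) with hPD0oKdef
  set Tp0oK := prob (Function.update (Function.update (Function.update p f₃ 0) f₂ 0) f₁ 0) (TEvent ends a₂ u c ∩ connEvent ends a₂ o) with hTp0oKdef
  have hD0 : 0 ≤ D0 := prob_nonneg hp0 _
  have ht0 : 0 ≤ t0 := prob_nonneg hp0 _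
  have htp0 : 0 ≤ tp0 := prob_nonneg hp0 _
  have ha0 : 0 ≤ a := hp.nonneg f₁
  have ha1 : a ≤ 1 := hp.le_one f₁
  have hs0 : 0 ≤ s := hp.nonneg f₂
  have hs1 : s ≤ 1 := hp.le_one f₂
  have hk0 : 0 ≤ k := hp.nonneg f₃
  have hk1 : k ≤ 1 := hp.le_one f₃
  set Z := prob p (avoidAll ends a₂ {u}) with hZdef
  set D := prob p (PDEvent ends u a₂ c) with hDdef
  set t := prob p (TEvent ends u a₂ c) with htdef
  set tp := prob p (TEvent ends a₂ u c) with htpdef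
  set hb := prob p (connEvent ends a₂ b) with hhbdef
  set d0 := prob p (avoidAll ends a₂ {c}) with hd0def
  set TpbL := prob p (TEvent ends a₂ u c ∩ connEvent ends u b) with hTpbLdef
  set TbK := prob p (TEvent ends u a₂ c ∩ connEvent ends a₂ b) with hTbKdef
  set TbL := prob p (TEvent ends u a₂ c ∩ connEvent ends u b) with hTbLdef
  set TpbK := prob p (TEvent ends a₂ u c ∩ connEvent ends a₂ b) with hTpbKdef
  set PDbL := prob p (PDEvent ends u a₂ c ∩ connEvent ends u b) with hPDbLdef
  set PDbK := prob p (PDEvent ends u a₂ c ∩ connEvent ends a₂ b) with hPDbKdef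
  set PDoK := prob p (PDEvent ends u a₂ c ∩ connEvent ends a₂ o) with hPDoKdef
  set TpoK := prob p (TEvent ends a₂ u c ∩ connEvent ends a₂ o) with hTpoKdef
  set TpoKbK := prob p (TEvent ends a₂ u c ∩ (connEvent ends a₂ o ∩ connEvent ends a₂ b)) with hTpoKbKdef
  set PDoKbL := prob p (PDEvent ends u a₂ c ∩ (connEvent ends a₂ o ∩ connEvent ends u b)) with hPDoKbLdef
  set TpoKbL := prob p (TEvent ends a₂ u c ∩ (connEvent ends a₂ o ∩ connEvent ends u b)) with hTpoKbLdef
  have hZ : Z = ((((1 - a) * (1 - s) * (1 - k)) + (a * (1 - s) * (1 - k)) + ((1 - a) * s * (1 - k)) + ((1 - a) * (1 - s) * k)) * (D0 + t0 + tp0) + (a * (1 - s) * k) * (D0 + t0) + ((1 - a) * s * k) * (D0 + tp0)) := by linear_combination hZ_tab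
  have hD : D = ((((1 - a) * (1 - s) * (1 - k)) + (a * (1 - s) * (1 - k)) + ((1 - a) * s * (1 - k)) + ((1 - a) * (1 - s) * k)) * D0) := by linear_combination hD_tab
  have ht : t = ((((1 - a) * (1 - s) * (1 - k)) + (a * (1 - s) * (1 - k)) + ((1 - a) * s * (1 - k)) + ((1 - a) * (1 - s) * k)) * t0 + (a * (1 - s) * k) * (D0 + t0)) := by linear_combination ht_tab
  have htp : tp = ((((1 - a) * (1 - s) * (1 - k)) + (a * (1 - s) * (1 - k)) + ((1 - a) * s * (1 - k)) + ((1 - a) * (1 - s) * k)) * tp0 + ((1 - a) * s * k) * (D0 + tp0)) := by linear_combination htp_tab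
  have hhb : hb = (a + (1 - a) * (s * (1 - k) * (1 - (D0 + t0 + tp0)) + (1 - s) * k * (1 - d00) + s * k * (1 - (D0 + tp0)))) := by linear_combination hhb_tab
  have hd0 : d0 = ((((1 - a) * (1 - s) * (1 - k)) + (a * (1 - s) * (1 - k)) + ((1 - a) * s * (1 - k)) + ((1 - a) * (1 - s) * k)) * d00 + (a * s * (1 - k)) * dcu + ((1 - a) * s * k) * (D0 + tp0)) := by linear_combination hd0_tab
  have hTpbL : TpbL = ((((1 - a) * s * (1 - k)) + ((1 - a) * (1 - s) * k)) * tp0 + ((1 - a) * s * k) * (D0 + tp0)) := by linear_combination hTpbL_tab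
  have hTbK : TbK = (((a * (1 - s) * (1 - k)) + ((1 - a) * (1 - s) * k)) * t0 + (a * (1 - s) * k) * (D0 + t0)) := by linear_combination hTbK_tab
  have hTbL : TbL = (((1 - a) * s * (1 - k)) * t0) := by linear_combination hTbL_tab
  have hTpbK : TpbK = ((a * (1 - s) * (1 - k)) * tp0) := by linear_combination hTpbK_tab
  have hPDbL : PDbL = (((1 - a) * s * (1 - k)) * D0) := by linear_combination hPDbL_tab
  have hPDbK : PDbK = ((a * (1 - s) * (1 - k)) * D0) := by linear_combination hPDbK_tab
  have hPDoK : PDoK = ((((1 - a) * (1 - s) * (1 - k)) + (a * (1 - s) * (1 - k)) + ((1 - a) * s * (1 - k)) + ((1 - a) * (1 - s) * k)) * PD0oK) := by linear_combination hPDoK_tab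
  have hTpoK : TpoK = ((((1 - a) * (1 - s) * (1 - k)) + (a * (1 - s) * (1 - k)) + ((1 - a) * s * (1 - k)) + ((1 - a) * (1 - s) * k)) * Tp0oK + ((1 - a) * s * k) * (PD0oK + Tp0oK)) := by linear_combination hTpoK_tab
  have hTpoKbK : TpoKbK = ((a * (1 - s) * (1 - k)) * Tp0oK) := by linear_combination hTpoKbK_tab
  have hPDoKbL : PDoKbL = (((1 - a) * s * (1 - k)) * PD0oK) := by linear_combination hPDoKbL_tab
  have hTpoKbL : TpoKbL = ((((1 - a) * s * (1 - k)) + ((1 - a) * (1 - s) * k)) * Tp0oK + ((1 - a) * s * k) * (PD0oK + Tp0oK)) := by linear_combination hTpoKbL_tab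
  have hgap' : gap p ends u a₂ b = (PDbK + TbK + TpbK) - (PDbL + TbL + TpbL) := by linear_combination hgap
  have hsig' : D0 + tp0 ≤ d00 := hsig
  have hh' : D0 + t0 + tp0 ≤ 1 := hh
  have hmu' : d00 + t0 ≤ 1 := hmu
  have hHs' : dcu * (D0 + t0 + tp0) ≤ D0 := hHs
  have hdcu' : dcu = d00 - tp0 := hdcu
  have hH0' : 0 ≤ tp0 * PD0oK - D0 * Tp0oK := hH0
  have hK := mixK_of_table a s k Z D t tp hb d0 (gap p ends u a₂ b) TpbL TbK TbL TpbK PDbL PDbK PDoK TpoK TpoKbK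
    PDoKbL TpoKbL D0 t0 tp0 d00 dcu PD0oK Tp0oK ha0 ha1 hs0 hs1 hk0 hk1 hD0 ht0 htp0 hsig' hh' hmu' hHs' hdcu'
    hH0' hZ hD ht htp hhb hd0 hgap' hTpbL hTbK hTbL hTpbK hPDbL hPDbK hPDoK hTpoK hTpoKbK hPDoKbL hTpoKbL
  linarith [hK]

set_option maxHeartbeats 4000000 in
/-- **The `o ∈ L` half on the 3-coin class**: `0 ≤ T2oL`. -/
theorem T2oL_nonneg_coin3 (hp : IsProbVec p)
    (hf₁ : ends f₁ = s(b, a₂)) (hf₂ : ends f₂ = s(b, u)) (hf₃ : ends f₃ = s(b, c))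
    (hstar : ∀ e, (∃ y, ends e = s(b, y)) → e = f₁ ∨ e = f₂ ∨ e = f₃)
    (hua : u ≠ a₂) (hcu : c ≠ u) (hca : c ≠ a₂) (hub : u ≠ b) (ha2b : a₂ ≠ b) (hcb : c ≠ b)
    (hob : o ≠ b) :
    0 ≤ T2oL p ends o a₂ c b u := by
  refine MixL.T2oL_nonneg_of_mixL p ends o a₂ c b u hp ?_
  unfold EQb3 PDb EQ3
  simp only [prob_univ]
  -- the coins are distinct edges
  have h12 : f₁ ≠ f₂ := by
    intro h
    rw [h, hf₂] at hf₁
    rcases Sym2.eq_iff.1 hf₁ with ⟨_, h2⟩ | ⟨h1, _⟩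
    · exact hua h2
    · exact ha2b h1.symm
  have h13 : f₁ ≠ f₃ := by
    intro h
    rw [h, hf₃] at hf₁
    rcases Sym2.eq_iff.1 hf₁ with ⟨_, h2⟩ | ⟨h1, _⟩
    · exact hca h2
    · exact ha2b h1.symm
  have h23 : f₂ ≠ f₃ := by
    intro h
    rw [h, hf₃] at hf₂
    rcases Sym2.eq_iff.1 hf₂ with ⟨_, h2⟩ | ⟨h1, _⟩
    · exact hcu h2
    · exact hub h1.symm
  -- the pinned (outside) measure and the outside facts
  have hp0 : IsProbVec (Function.update (Function.update (Function.update p f₃ 0) f₂ 0) f₁ 0) :=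
    ((hp.update f₃ le_rfl zero_le_one).update f₂ le_rfl zero_le_one).update f₁ le_rfl zero_le_one
  have hsig := fact_sig (Function.update (Function.update (Function.update p f₃ 0) f₂ 0) f₁ 0) ends u a₂ c hp0
  have hmu := fact_mu (Function.update (Function.update (Function.update p f₃ 0) f₂ 0) f₁ 0) ends u a₂ c hp0
  have hHs := fact_Hs (Function.update (Function.update (Function.update p f₃ 0) f₂ 0) f₁ 0) ends u a₂ c hp0
  have hh := prob_le_one hp0 (avoidAll ends a₂ {u})
  have hdcu := out_dcu (Function.update (Function.update (Function.update p f₃ 0) f₂ 0) f₁ 0) ends u a₂ c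
  have hgap := gap_eq_Q p ends u a₂ b
  rw [Qsplit p ends u a₂ c, Qsplit p ends u a₂ c] at hgap
  rw [Qsplit_univ (Function.update (Function.update (Function.update p f₃ 0) f₂ 0) f₁ 0) ends u a₂ c] at hHs hh
  have hdlt := ToL_mul_D_le (Function.update (Function.update (Function.update p f₃ 0) f₂ 0) f₁ 0) hp0
    ends o u a₂ c
  have hOU : T2oL p ends u a₂ c b u = T2oL p ends u a₂ c b u := rfl
  conv_rhs at hOU => unfold T2oL EQb3 PDb EQ3
  simp only [connEvent_self, Set.inter_univ, Set.univ_inter, prob_univ] at hOU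
  have hZ_tab := table_Z p ends u a₂ c b f₁ f₂ f₃ hf₁ hf₂ hf₃ hstar h12 h13 h23 hub ha2b
  have hD_tab := table_D p ends u a₂ c b f₁ f₂ f₃ hf₁ hf₂ hf₃ hstar h12 h13 h23 hub ha2b hcb
  have ht_tab := table_t p ends u a₂ c b f₁ f₂ f₃ hf₁ hf₂ hf₃ hstar h12 h13 h23 hub ha2b hcb
  have htp_tab := table_tp p ends u a₂ c b f₁ f₂ f₃ hf₁ hf₂ hf₃ hstar h12 h13 h23 hub ha2b hcb
  have hhb_tab := table_hb p ends u a₂ c b f₁ f₂ f₃ hf₁ hf₂ hf₃ hstar h12 h13 h23 ha2b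
  have hd0_tab := table_d0 p ends u a₂ c b f₁ f₂ f₃ hf₁ hf₂ hf₃ hstar h12 h13 h23 ha2b hcb
  have hTpbL_tab := table_TpbL p ends u a₂ c b f₁ f₂ f₃ hf₁ hf₂ hf₃ hstar h12 h13 h23 hub ha2b hcb
  have hTbK_tab := table_TbK p ends u a₂ c b f₁ f₂ f₃ hf₁ hf₂ hf₃ hstar h12 h13 h23 hub ha2b hcb
  have hTbL_tab := table_TbL p ends u a₂ c b f₁ f₂ f₃ hf₁ hf₂ hf₃ hstar h12 h13 h23 hub ha2b hcb
  have hTpbK_tab := table_TpbK p ends u a₂ c b f₁ f₂ f₃ hf₁ hf₂ hf₃ hstar h12 h13 h23 hub ha2b hcb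
  have hPDbL_tab := table_PDbL p ends u a₂ c b f₁ f₂ f₃ hf₁ hf₂ hf₃ hstar h12 h13 h23 hub ha2b hcb
  have hPDbK_tab := table_PDbK p ends u a₂ c b f₁ f₂ f₃ hf₁ hf₂ hf₃ hstar h12 h13 h23 hub ha2b hcb
  have hPDoL_tab := table_PDoL p ends o u a₂ c b f₁ f₂ f₃ hf₁ hf₂ hf₃ hstar h12 h13 h23 hub ha2b hcb hob
  have hToL_tab := table_ToL p ends o u a₂ c b f₁ f₂ f₃ hf₁ hf₂ hf₃ hstar h12 h13 h23 hub ha2b hcb hob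
  have hToLbL_tab := table_ToLbL p ends o u a₂ c b f₁ f₂ f₃ hf₁ hf₂ hf₃ hstar h12 h13 h23 hub ha2b hcb hob
  have hPDoLbK_tab := table_PDoLbK p ends o u a₂ c b f₁ f₂ f₃ hf₁ hf₂ hf₃ hstar h12 h13 h23 hub ha2b hcb hob
  have hToLbK_tab := table_ToLbK p ends o u a₂ c b f₁ f₂ f₃ hf₁ hf₂ hf₃ hstar h12 h13 h23 hub ha2b hcb hob
  simp only [out_W0 (Function.update (Function.update (Function.update p f₃ 0) f₂ 0) f₁ 0) ends u a₂ c, out_P00 (Function.update (Function.update (Function.update p f₃ 0) f₂ 0) f₁ 0) ends u a₂ c, out_hua (Function.update (Function.update (Function.update p f₃ 0) f₂ 0) f₁ 0) ends u a₂, out_hca (Function.update (Function.update (Function.update p f₃ 0) f₂ 0) f₁ 0) ends a₂ c, out_hor (Function.update (Function.update (Function.update p f₃ 0) f₂ 0) f₁ 0) ends u a₂ c, out_W0oL (Function.update (Function.update (Function.update p f₃ 0) f₂ 0) f₁ 0) ends o u a₂ c, Qsplit_univ (Function.update (Function.update (Function.update p f₃ 0) f₂ 0) f₁ 0) ends u a₂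 c, prob_univ] at *
  set a := p f₁ with hadef
  set s := p f₂ with hsdef
  set k := p f₃ with hkdef
  set D0 := prob (Function.update (Function.update (Function.update p f₃ 0) f₂ 0) f₁ 0) (PDEvent ends u a₂ c) with hD0def
  set t0 := prob (Function.update (Function.update (Function.update p f₃ 0) f₂ 0) f₁ 0) (TEvent ends u a₂ c) with ht0def
  set tp0 := prob (Function.update (Function.update (Function.update p f₃ 0) f₂ 0) f₁ 0) (TEvent ends a₂ u c) with htp0def
  set d00 := prob (Function.update (Function.update (Function.update p f₃ 0) f₂ 0) f₁ 0) (avoidAll ends a₂ {c}) with hd00def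
  set dcu := prob (Function.update (Function.update (Function.update p f₃ 0) f₂ 0) f₁ 0) (avoidAll ends a₂ {c} ∩ (connEvent ends u c)ᶜ) with hdcudef
  set PD0oL := prob (Function.update (Function.update (Function.update p f₃ 0) f₂ 0) f₁ 0) (PDEvent ends u a₂ c ∩ connEvent ends u o) with hPD0oLdef
  set T0oL := prob (Function.update (Function.update (Function.update p f₃ 0) f₂ 0) f₁ 0) (TEvent ends u a₂ c ∩ connEvent ends u o) with hT0oLdef
  have hD0 : 0 ≤ D0 := prob_nonneg hp0 _
  have ht0 : 0 ≤ t0 := prob_nonneg hp0 _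
  have htp0 : 0 ≤ tp0 := prob_nonneg hp0 _
  have ha0 : 0 ≤ a := hp.nonneg f₁
  have ha1 : a ≤ 1 := hp.le_one f₁
  have hs0 : 0 ≤ s := hp.nonneg f₂
  have hs1 : s ≤ 1 := hp.le_one f₂
  have hk0 : 0 ≤ k := hp.nonneg f₃
  have hk1 : k ≤ 1 := hp.le_one f₃
  set Z := prob p (avoidAll ends a₂ {u}) with hZdef
  set D := prob p (PDEvent ends u a₂ c) with hDdef
  set t := prob p (TEvent ends u a₂ c) with htdef
  set tp := prob p (TEvent ends a₂ u c) with htpdef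
  set hb := prob p (connEvent ends a₂ b) with hhbdef
  set d0 := prob p (avoidAll ends a₂ {c}) with hd0def
  set TpbL := prob p (TEvent ends a₂ u c ∩ connEvent ends u b) with hTpbLdef
  set TbK := prob p (TEvent ends u a₂ c ∩ connEvent ends a₂ b) with hTbKdef
  set TbL := prob p (TEvent ends u a₂ c ∩ connEvent ends u b) with hTbLdef
  set TpbK := prob p (TEvent ends a₂ u c ∩ connEvent ends a₂ b) with hTpbKdef
  set PDbL := prob p (PDEvent ends u a₂ c ∩ connEvent ends u b) with hPDbLdef
  set PDbK := prob p (PDEvent ends u a₂ c ∩ connEvent ends a₂ b) with hPDbKdef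
  set PDoL := prob p (PDEvent ends u a₂ c ∩ connEvent ends u o) with hPDoLdef
  set ToL := prob p (TEvent ends u a₂ c ∩ connEvent ends u o) with hToLdef
  set ToLbL := prob p (TEvent ends u a₂ c ∩ (connEvent ends u o ∩ connEvent ends u b)) with hToLbLdef
  set PDoLbK := prob p (PDEvent ends u a₂ c ∩ (connEvent ends u o ∩ connEvent ends a₂ b)) with hPDoLbKdef
  set ToLbK := prob p (TEvent ends u a₂ c ∩ (connEvent ends u o ∩ connEvent ends a₂ b)) with hToLbKdef
  have hZ : Z = ((((1 - a) * (1 - s) * (1 - k)) + (a * (1 - s) * (1 - k)) + ((1 - a) * s * (1 - k)) + ((1 - a) * (1 - s) * k)) * (D0 + t0 + tp0) + (a * (1 - s) * k) * (D0 + t0) + ((1 - a) * s * k) * (D0 + tp0)) := by linear_combination hZ_tab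
  have hD : D = ((((1 - a) * (1 - s) * (1 - k)) + (a * (1 - s) * (1 - k)) + ((1 - a) * s * (1 - k)) + ((1 - a) * (1 - s) * k)) * D0) := by linear_combination hD_tab
  have ht : t = ((((1 - a) * (1 - s) * (1 - k)) + (a * (1 - s) * (1 - k)) + ((1 - a) * s * (1 - k)) + ((1 - a) * (1 - s) * k)) * t0 + (a * (1 - s) * k) * (D0 + t0)) := by linear_combination ht_tab
  have htp : tp = ((((1 - a) * (1 - s) * (1 - k)) + (a * (1 - s) * (1 - k)) + ((1 - a) * s * (1 - k)) + ((1 - a) * (1 - s) * k)) * tp0 + ((1 - a) * s * k) * (D0 + tp0)) := by linear_combination htp_tab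
  have hhb : hb = (a + (1 - a) * (s * (1 - k) * (1 - (D0 + t0 + tp0)) + (1 - s) * k * (1 - d00) + s * k * (1 - (D0 + tp0)))) := by linear_combination hhb_tab
  have hd0 : d0 = ((((1 - a) * (1 - s) * (1 - k)) + (a * (1 - s) * (1 - k)) + ((1 - a) * s * (1 - k)) + ((1 - a) * (1 - s) * k)) * d00 + (a * s * (1 - k)) * dcu + ((1 - a) * s * k) * (D0 + tp0)) := by linear_combination hd0_tab
  have hTpbL : TpbL = ((((1 - a) * s * (1 - k)) + ((1 - a) * (1 - s) * k)) * tp0 + ((1 - a) * s * k) * (D0 + tp0)) := by linear_combination hTpbL_tab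
  have hTbK : TbK = (((a * (1 - s) * (1 - k)) + ((1 - a) * (1 - s) * k)) * t0 + (a * (1 - s) * k) * (D0 + t0)) := by linear_combination hTbK_tab
  have hTbL : TbL = (((1 - a) * s * (1 - k)) * t0) := by linear_combination hTbL_tab
  have hTpbK : TpbK = ((a * (1 - s) * (1 - k)) * tp0) := by linear_combination hTpbK_tab
  have hPDbL : PDbL = (((1 - a) * s * (1 - k)) * D0) := by linear_combination hPDbL_tab
  have hPDbK : PDbK = ((a * (1 - s) * (1 - k)) * D0) := by linear_combination hPDbK_tab
  have hPDoL : PDoL = ((((1 - a) * (1 - s) * (1 - k)) + (a * (1 - s) * (1 - k)) + ((1 - a) * s * (1 - k)) + ((1 - a) * (1 - s) * k)) * PD0oL) := by linear_combination hPDoL_tab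
  have hToL : ToL = ((((1 - a) * (1 - s) * (1 - k)) + (a * (1 - s) * (1 - k)) + ((1 - a) * s * (1 - k)) + ((1 - a) * (1 - s) * k)) * T0oL + (a * (1 - s) * k) * (PD0oL + T0oL)) := by linear_combination hToL_tab
  have hToLbL : ToLbL = (((1 - a) * s * (1 - k)) * T0oL) := by linear_combination hToLbL_tab
  have hPDoLbK : PDoLbK = ((a * (1 - s) * (1 - k)) * PD0oL) := by linear_combination hPDoLbK_tab
  have hToLbK : ToLbK = (((a * (1 - s) * (1 - k)) + ((1 - a) * (1 - s) * k)) * T0oL + (a * (1 - s) * k) * (PD0oL + T0oL)) := by linear_combination hToLbK_tab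
  have hgap' : gap p ends u a₂ b = (PDbK + TbK + TpbK) - (PDbL + TbL + TpbL) := by linear_combination hgap
  have hsig' : D0 + tp0 ≤ d00 := hsig
  have hh' : D0 + t0 + tp0 ≤ 1 := hh
  have hmu' : d00 + t0 ≤ 1 := hmu
  have hHs' : dcu * (D0 + t0 + tp0) ≤ D0 := hHs
  have hdcu' : dcu = d00 - tp0 := hdcu
  set OU := T2oL p ends u a₂ c b u with hOUdef
  have hOU0 : 0 ≤ OU := T2oL_root_nonneg p ends a₂ c b u hp
  have hPD0oL : 0 ≤ PD0oL := prob_nonneg hp0 _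
  have hT0oL : 0 ≤ T0oL := prob_nonneg hp0 _
  have hdlt' : 0 ≤ t0 * PD0oL - D0 * T0oL := by linarith [hdlt]
  have hOU' : OU = (((D * hb + d0 * (gap p ends u a₂ b)) + (1 * (TpbL + TbK - TbL - TpbK) + 1 * (PDbL + PDbK) + hb * (tp - t) + hb * Z - (1 - d0) * (gap p ends u a₂ b))) * D + 2 * (D * hb + d0 * (gap p ends u a₂ b)) * t + 2 * (1 * D + d0 * Z) * TbL - 2 * (1 * D + d0 * Z) * (PDbK + TbK)) := by linarith [hOU]
  have hL := mixL_of_table a s k Z D t tp hb d0 (gap p ends u a₂ b) TpbL TbK TbL TpbK PDbL PDbK PDoL ToL ToLbL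
    PDoLbK ToLbK OU D0 t0 tp0 d00 dcu PD0oL T0oL ha0 ha1 hs0 hs1 hk0 hk1 hD0 ht0 htp0 hsig' hh' hmu' hHs' hdcu'
    hdlt' hPD0oL hT0oL hOU0 hOU' hZ hD ht htp hhb hd0 hgap' hTpbL hTbK hTbL hTpbK hPDbL hPDbK hPDoL hToL
    hToLbL hPDoLbK hToLbK
  linarith [hL]

/-- **(G4-u), the 3-coin class: `0 ≤ T2`** — `b` adjacent exactly to `a₂` (`f₁`), `u` (`f₂`) and `c`
(`f₃`), every weight vector. -/
theorem T2_nonneg_coin3 (hp : IsProbVec p)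
    (hf₁ : ends f₁ = s(b, a₂)) (hf₂ : ends f₂ = s(b, u)) (hf₃ : ends f₃ = s(b, c))
    (hstar : ∀ e, (∃ y, ends e = s(b, y)) → e = f₁ ∨ e = f₂ ∨ e = f₃)
    (hua : u ≠ a₂) (hcu : c ≠ u) (hca : c ≠ a₂) (hub : u ≠ b) (ha2b : a₂ ≠ b) (hcb : c ≠ b)
    (hob : o ≠ b) :
    0 ≤ T2 p ends o a₂ c b u :=
  T2_nonneg_of_halves p ends o a₂ c b u
    (T2oL_nonneg_coin3 p ends o u a₂ c b f₁ f₂ f₃ hp hf₁ hf₂ hf₃ hstar hua hcu hca hub ha2b hcb hob)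
    (T2oK_nonneg_coin3 p ends o u a₂ c b f₁ f₂ f₃ hp hf₁ hf₂ hf₃ hstar hua hcu hca hub ha2b hcb hob)

/-- **(G4-u) on the 3-coin class**: (HCOV) for a root `a₁` pendant at the unmarked `u` follows from
(HCOV) at the smaller instance `(o, u, a₂, c, b)` whenever `b` is adjacent exactly to `a₂`, `u` and
`c` — for every leaf weight and every weight vector. -/
theorem HCov_root_leaf_u_of_coin3 (hp : IsProbVec p) {f : E} {a₁ : V} (hf : ends f = s(a₁, u))
    (hleaf : ∀ e, a₁ ∈ ends e → e = f) (h1u : a₁ ≠ u) (h12 : a₁ ≠ a₂) (h1c : a₁ ≠ c)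
    (h1o : a₁ ≠ o) (h1b : a₁ ≠ b)
    (hf₁ : ends f₁ = s(b, a₂)) (hf₂ : ends f₂ = s(b, u)) (hf₃ : ends f₃ = s(b, c))
    (hstar : ∀ e, (∃ y, ends e = s(b, y)) → e = f₁ ∨ e = f₂ ∨ e = f₃)
    (hua : u ≠ a₂) (hcu : c ≠ u) (hca : c ≠ a₂) (hub : u ≠ b) (ha2b : a₂ ≠ b) (hcb : c ≠ b)
    (hob : o ≠ b) (h3 : HCov p ends o u a₂ c b) : HCov p ends o a₁ a₂ c b :=
  HCov_root_leaf_u_of p ends hp hf hleaf h1u h12 h1c h1o h1b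
    (T2_nonneg_coin3 p ends o u a₂ c b f₁ f₂ f₃ hp hf₁ hf₂ hf₃ hstar hua hcu hca hub ha2b hcb hob) h3

end Main

end Coin3

end RootLeafU

end Summit.Ventures.PercRepro2
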